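import Summits.CriticalPhenomena.PercolationContinuityZ3.Theorems.Transplant.SkelPhiFaceNumsBox
import Summits.CriticalPhenomena.PercolationContinuityZ3.Theorems.Transplant.SkelPhiFaceSchedBoxes2
import Summits.CriticalPhenomena.PercolationContinuityZ3.Theorems.Transplant.SkelPhiRootBridgeGeom
import HarnessLib

/-!
# N1 ({±1} node), (F) inner route, part R5b-x (hp-8 g33): **THE x-RUN'S PER-REGION FOOTPRINT FROM LINEAR FLOORS** — the fields
# `PLO/PHI, hreg, hP0–hP3, hPf₁₂₃` of `FaceRunNums3` (x-run = along run of an x-face / tangential run of a y′-face) produced from SIX LINEAR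
# INTEGER INEQUALITIES per region `k` (`FX1–FX6`, in stride units `κ₀ = c₀/A`, `κ₁ = c₁/A`, `D = A²·mod`): the reading values are chosen to be the
# reading formulas themselves, the region boxes are `xRunSched_region_subset`, and the footprint inequalities follow from `read0_lo/hi_bounds`,
# `read1_lo/hi_bounds`.
builds on p205010 (kernel theorem, internal audit signed; external expert review pending) — nothing in this file uses p205010; no claim about the open node.
Lane `prim-bschramm`, seat `prim-hp-8` (gen 33); helper file (`--supports stmt-CriticalPhenomena-4575 --as helper`).
* defs `Skelφ.xBoxLoA/xBoxHiA/xBoxB` (region `k` box of the x-run), **`Skelφ.xRun_footprint_of_floors`**.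
[cite: KozmaNitzan2024, §4 Lemma 11 (pp. 22–23)] [cite: MartineauTassion2017, §4.1, §4.3 Lemma 4.2]
-/

namespace Summit.CriticalPhenomena.PercolationContinuityZ3.Theorems.Transplant

namespace Skelφ

open Literature.Probability.Percolation Literature.Probability.LatticeModels
open Literature.Probability.Percolation.KozmaNitzan.Cells (oth oth_ne sgOf sgOf_sign eq_oth_of_ne oth_oth)
open ChainPlanar ChainPara
open TwoAxis.Para (modulus coarse lam0 lam1)

/-- Along lower end of region `k` of the x-run: `k·n − q − k·R′ − R′ − n`. [folklore] -/
def xBoxLoA (n q R' : ℕ) (k : ℕ) : ℤ := (k : ℤ) * n - q - (k : ℤ) * R' - R' - n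

/-- Along upper end of region `k` of the x-run: `k·n + q + k·R′ + R′ + n`. [folklore] -/
def xBoxHiA (n q R' : ℕ) (k : ℕ) : ℤ := (k : ℤ) * n + q + (k : ℤ) * R' + R' + n

/-- Level half-height of region `k` of the x-run: `W + k·R′ + R′ + Lb`, `W = nℓ/U + 1`, `Lb = 3nℓ/U + 1`. [folklore] -/
def xBoxB (n ℓ : ℕ) (h : ℤ) (R' : ℕ) (k : ℕ) : ℤ :=
  ((n * ℓ / shearUnit n h + 1 : ℕ) : ℤ) + (k : ℤ) * R' + R' + ((3 * (n * ℓ) / shearUnit n h + 1 : ℕ) : ℤ)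

/-- `0 ≤ xBoxB`. [folklore] -/
theorem xBoxB_nonneg (n ℓ : ℕ) (h : ℤ) (R' k : ℕ) : 0 ≤ xBoxB n ℓ h R' k := by unfold xBoxB; positivity

/-- The x-run's region `k` inside the box `[xBoxLoA, xBoxHiA] × [−xBoxB, xBoxB]`. [folklore] -/
theorem xRunSched_region_subset_xBox (n ℓ : ℕ) (h : ℤ) (R' q N k : ℕ) :
    (xRunSched n ℓ h R' q N).region k ⊆ Finset.Icc (pt (xBoxLoA n q R' k) (-xBoxB n ℓ h R' k)) (pt (xBoxHiA n q R' k) (xBoxB n ℓ h R' k)) := by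
  intro y hy
  have hy' := xRunSched_region_subset n ℓ h R' q N k hy
  rw [mem_Icc_pt_iff] at hy' ⊢
  obtain ⟨⟨h1, h2⟩, h3, h4⟩ := hy'
  unfold xBoxLoA xBoxHiA xBoxB
  refine ⟨⟨by linarith, by linarith⟩, by linarith, by linarith⟩

variable {V : Type}

/-- **THE x-RUN'S PER-REGION FOOTPRINT FROM LINEAR FLOORS** (see the module docstring): for the x-run `xRunSched n ℓ h R′ q Nr` read in
`runX φ cL n h σ` with origin cell readings `e₀ = ⌊c₀λ₀(yL)⌋`, `e₁ = ⌊c₁λ₁(yL)⌋`, there are reading boxes `PLO PHI` satisfying the fields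
`hreg, hP0–hP3, hPf₁₂₃` of `FaceRunNums3`, provided the six linear floors hold for every `k ≤ Nr`. -/
theorem xRun_footprint_of_floors {A vα vβ c₀ c₁ D κ₀ κ₁ mod : ℤ} {n : ℕ} (hn : 1 ≤ n) (h : ℤ) (hA : 0 < A) (hκ₀ : 0 ≤ κ₀)
    (hc0 : c₀ = A * κ₀) (hc1 : c₁ = A * κ₁) (hmod : modulus n h vα vβ = mod) (hmod0 : 0 < mod) (hD : D = A ^ 2 * mod) {Vb : ℤ} (hv : |vα| ≤ Vb)
    (yL : Site 2) {σ : ℤ} (du : MDir) (hσdu : sgOf du = σ) (hdu : du.1 = 0) (ℓ R' q Nr : ℕ) {flo fhi fw : ℤ}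
    -- the six floors, per region
    (FX1 : σ = 1 → ∀ k ≤ Nr, (n : ℤ) * mod * (flo - coarse c₀ (D / 2) D (lam0 A vα vβ yL)) ≤
      κ₀ * mod * xBoxLoA n q R' k - κ₀ * Vb * (shearUnit n h : ℤ) * (xBoxB n ℓ h R' k + 1) - κ₀ * n - n * mod)
    (FX2 : σ = 1 → ∀ k ≤ Nr, (n : ℤ) * mod * (coarse c₀ (D / 2) D (lam0 A vα vβ yL) + 1) + κ₀ * mod * xBoxHiA n q R' k +
      κ₀ * Vb * (shearUnit n h : ℤ) * (xBoxB n ℓ h R' k + 1) ≤ n * mod * fhi)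
    (FX3 : σ = -1 → ∀ k ≤ Nr, (n : ℤ) * mod * (flo + coarse c₀ (D / 2) D (lam0 A vα vβ yL) + 1) ≤
      κ₀ * mod * xBoxLoA n q R' k - κ₀ * Vb * (shearUnit n h : ℤ) * (xBoxB n ℓ h R' k + 1))
    (FX4 : σ = -1 → ∀ k ≤ Nr, -((n : ℤ) * mod * coarse c₀ (D / 2) D (lam0 A vα vβ yL)) + κ₀ * mod * xBoxHiA n q R' k +
      κ₀ * Vb * (shearUnit n h : ℤ) * (xBoxB n ℓ h R' k + 1) + κ₀ * n + n * mod ≤ n * mod * fhi)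
    (FX5 : ∀ k ≤ Nr, mod * (-fw - coarse c₁ (D / 2) D (lam1 A n h yL)) ≤ -(κ₁ * (shearUnit n h : ℤ) * (xBoxB n ℓ h R' k + 1)) - mod + 1)
    (FX6 : ∀ k ≤ Nr, mod * (coarse c₁ (D / 2) D (lam1 A n h yL) + 1) + κ₁ * ((shearUnit n h : ℤ) * xBoxB n ℓ h R' k + shearUnit n h - 1) ≤ mod * fw) :
    ∃ (PLO PHI : ℕ → Site 2),
      (∀ k ≤ Nr, (xRunSched n ℓ h R' q Nr).region k ⊆
        Finset.Icc (pt (xBoxLoA n q R' k) (-xBoxB n ℓ h R' k)) (pt (xBoxHiA n q R' k) (xBoxB n ℓ h R' k))) ∧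
      (∀ k ≤ Nr, PLO k 0 ≤ coarse c₀ (D / 2) D (lam0 A vα vβ yL) +
        (c₀ * (A * (modulus n h vα vβ * (min (sgOf du * xBoxLoA n q R' k) (sgOf du * xBoxHiA n q R' k)) -
          max (vα * ((shearUnit n h : ℤ) * (min (sgOf du * -xBoxB n ℓ h R' k) (sgOf du * xBoxB n ℓ h R' k) - 1)))
            (vα * ((shearUnit n h : ℤ) * (max (sgOf du * -xBoxB n ℓ h R' k) (sgOf du * xBoxB n ℓ h R' k)) + shearUnit n h - 1))) / n)) / D) ∧
      (∀ k ≤ Nr, coarse c₀ (D / 2) D (lam0 A vα vβ yL) +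
        (c₀ * (A * (modulus n h vα vβ * (max (sgOf du * xBoxLoA n q R' k) (sgOf du * xBoxHiA n q R' k)) -
          min (vα * ((shearUnit n h : ℤ) * (min (sgOf du * -xBoxB n ℓ h R' k) (sgOf du * xBoxB n ℓ h R' k) - 1)))
            (vα * ((shearUnit n h : ℤ) * (max (sgOf du * -xBoxB n ℓ h R' k) (sgOf du * xBoxB n ℓ h R' k)) + shearUnit n h - 1))) / n)) / D + 1 ≤ PHI k 0) ∧
      (∀ k ≤ Nr, PLO k 1 ≤ coarse c₁ (D / 2) D (lam1 A n h yL) +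
        (c₁ * (A * ((shearUnit n h : ℤ) * (min (sgOf du * -xBoxB n ℓ h R' k) (sgOf du * xBoxB n ℓ h R' k) - 1)))) / D) ∧
      (∀ k ≤ Nr, coarse c₁ (D / 2) D (lam1 A n h yL) +
        (c₁ * (A * ((shearUnit n h : ℤ) * (max (sgOf du * -xBoxB n ℓ h R' k) (sgOf du * xBoxB n ℓ h R' k)) + shearUnit n h - 1))) / D + 1 ≤ PHI k 1) ∧
      (∀ k ≤ Nr, sgOf du = 1 → flo ≤ PLO k du.1 ∧ PHI k du.1 ≤ fhi) ∧
      (∀ k ≤ Nr, sgOf du = -1 → flo ≤ -PHI k du.1 ∧ -PLO k du.1 ≤ fhi) ∧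
      (∀ k ≤ Nr, -fw ≤ PLO k (oth du.1) ∧ PHI k (oth du.1) ≤ fw) := by
  -- abbreviations
  set e₀ := coarse c₀ (D / 2) D (lam0 A vα vβ yL) with he₀
  set e₁ := coarse c₁ (D / 2) D (lam1 A n h yL) with he₁
  set U : ℤ := (shearUnit n h : ℤ) with hU
  have hU1 : 1 ≤ U := by rw [hU]; exact_mod_cast (show 1 ≤ shearUnit n h by unfold shearUnit; omega)
  have hn0 : (0 : ℤ) < n := by exact_mod_cast hn
  have hnm : 0 < (n : ℤ) * mod := mul_pos hn0 hmod0
  set aL := xBoxLoA n q R' with haL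
  set aH := xBoxHiA n q R' with haH
  set Bk := xBoxB n ℓ h R' with hBk
  have hB0 : ∀ k, 0 ≤ Bk k := fun k => xBoxB_nonneg n ℓ h R' k
  have hLH : ∀ k, aL k ≤ aH k := fun k => by simp only [haL, haH, xBoxLoA, xBoxHiA]; linarith [show (0:ℤ) ≤ q from by positivity, show (0:ℤ) ≤ (k:ℤ) * R' from by positivity]
  -- the reading terms (as functions of the box ends)
  let X0lo : ℕ → ℤ := fun k => (c₀ * (A * (modulus n h vα vβ * (min (sgOf du * aL k) (sgOf du * aH k)) -
      max (vα * (U * (min (sgOf du * -Bk k) (sgOf du * Bk k) - 1))) (vα * (U * (max (sgOf du * -Bk k) (sgOf du * Bk k)) + U - 1))) / n)) / D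
  let X0hi : ℕ → ℤ := fun k => (c₀ * (A * (modulus n h vα vβ * (max (sgOf du * aL k) (sgOf du * aH k)) -
      min (vα * (U * (min (sgOf du * -Bk k) (sgOf du * Bk k) - 1))) (vα * (U * (max (sgOf du * -Bk k) (sgOf du * Bk k)) + U - 1))) / n)) / D
  let X1lo : ℕ → ℤ := fun k => (c₁ * (A * (U * (min (sgOf du * -Bk k) (sgOf du * Bk k) - 1)))) / D
  let X1hi : ℕ → ℤ := fun k => (c₁ * (A * (U * (max (sgOf du * -Bk k) (sgOf du * Bk k)) + U - 1))) / D
  refine ⟨fun k => pt (e₀ + X0lo k) (e₁ + X1lo k), fun k => pt (e₀ + X0hi k + 1) (e₁ + X1hi k + 1),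
    fun k _ => xRunSched_region_subset_xBox n ℓ h R' q Nr k, fun k _ => le_of_eq (pt_zero _ _), fun k _ => le_of_eq (pt_zero _ _).symm,
    fun k _ => le_of_eq (pt_one _ _), fun k _ => le_of_eq (pt_one _ _).symm, ?_, ?_, ?_⟩
  · -- σ = 1: along
    intro k hk h1
    rw [hdu]; simp only [pt_zero]
    have hσ1 : σ = 1 := by rw [← hσdu, h1]
    have hmb : min (sgOf du * -Bk k) (sgOf du * Bk k) = -Bk k := by rw [h1, one_mul, one_mul]; exact min_eq_left (by linarith [hB0 k])
    have hMb : max (sgOf du * -Bk k) (sgOf du * Bk k) = Bk k := by rw [h1, one_mul, one_mul]; exact max_eq_right (by linarith [hB0 k])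
    have hma : min (sgOf du * aL k) (sgOf du * aH k) = aL k := by rw [h1, one_mul, one_mul]; exact min_eq_left (hLH k)
    have hMa : max (sgOf du * aL k) (sgOf du * aH k) = aH k := by rw [h1, one_mul, one_mul]; exact max_eq_right (hLH k)
    have hlo := (read0_lo_bounds (U := U) hA hκ₀ hmod0 hn0 hc0 hD hv hU1 (hB0 k) (aL k)).1
    have hhi := (read0_hi_bounds (U := U) hA hκ₀ hmod0 hn0 hc0 hD hv hU1 (hB0 k) (aH k)).2
    have f1 := FX1 hσ1 k hk
    have f2 := FX2 hσ1 k hk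
    constructor
    · show flo ≤ e₀ + X0lo k
      have e : X0lo k = (c₀ * (A * (mod * aL k - max (vα * (U * (-Bk k - 1))) (vα * (U * Bk k + U - 1))) / n)) / D := by
        simp only [X0lo, hmod, hma, hmb, hMb]
      rw [e]
      exact le_of_mul_le_mul_left (by linarith) hnm
    · show e₀ + X0hi k + 1 ≤ fhi
      have e : X0hi k = (c₀ * (A * (mod * aH k - min (vα * (U * (-Bk k - 1))) (vα * (U * Bk k + U - 1))) / n)) / D := by
        simp only [X0hi, hmod, hMa, hmb, hMb]
      rw [e]
      exact le_of_mul_le_mul_left (by linarith) hnm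
  · -- σ = −1: along
    intro k hk h1
    rw [hdu]; simp only [pt_zero]
    have hσ1 : σ = -1 := by rw [← hσdu, h1]
    have hmb : min (sgOf du * -Bk k) (sgOf du * Bk k) = -Bk k := by
      rw [h1, neg_one_mul, neg_one_mul, neg_neg]; exact min_eq_right (by linarith [hB0 k])
    have hMb : max (sgOf du * -Bk k) (sgOf du * Bk k) = Bk k := by
      rw [h1, neg_one_mul, neg_one_mul, neg_neg]; exact max_eq_left (by linarith [hB0 k])
    have hma : min (sgOf du * aL k) (sgOf du * aH k) = -aH k := by rw [h1, neg_one_mul, neg_one_mul]; exact min_eq_right (by linarith [hLH k])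
    have hMa : max (sgOf du * aL k) (sgOf du * aH k) = -aL k := by rw [h1, neg_one_mul, neg_one_mul]; exact max_eq_left (by linarith [hLH k])
    have hlo := (read0_lo_bounds (U := U) hA hκ₀ hmod0 hn0 hc0 hD hv hU1 (hB0 k) (-aH k)).1
    have hhi := (read0_hi_bounds (U := U) hA hκ₀ hmod0 hn0 hc0 hD hv hU1 (hB0 k) (-aL k)).2
    have f3 := FX3 hσ1 k hk
    have f4 := FX4 hσ1 k hk
    constructor
    · show flo ≤ -(e₀ + X0hi k + 1)
      have e : X0hi k = (c₀ * (A * (mod * (-aL k) - min (vα * (U * (-Bk k - 1))) (vα * (U * Bk k + U - 1))) / n)) / D := by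
        simp only [X0hi, hmod, hMa, hmb, hMb]
      rw [e]
      have : κ₀ * mod * (-aL k) = -(κ₀ * mod * aL k) := by ring
      exact le_of_mul_le_mul_left (by linarith) hnm
    · show -(e₀ + X0lo k) ≤ fhi
      have e : X0lo k = (c₀ * (A * (mod * (-aH k) - max (vα * (U * (-Bk k - 1))) (vα * (U * Bk k + U - 1))) / n)) / D := by
        simp only [X0lo, hmod, hma, hmb, hMb]
      rw [e]
      have : κ₀ * mod * (-aH k) = -(κ₀ * mod * aH k) := by ring
      exact le_of_mul_le_mul_left (by linarith) hnm
  · -- transverse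
    intro k hk
    rw [hdu, show oth (0 : Fin 2) = 1 from rfl]; simp only [pt_one]
    have hsg := sgOf_sign du
    have hmb : min (sgOf du * -Bk k) (sgOf du * Bk k) = -Bk k := by
      rcases hsg with h1 | h1
      · rw [h1, one_mul, one_mul]; exact min_eq_left (by linarith [hB0 k])
      · rw [h1, neg_one_mul, neg_one_mul, neg_neg]; exact min_eq_right (by linarith [hB0 k])
    have hMb : max (sgOf du * -Bk k) (sgOf du * Bk k) = Bk k := by
      rcases hsg with h1 | h1
      · rw [h1, one_mul, one_mul]; exact max_eq_right (by linarith [hB0 k])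
      · rw [h1, neg_one_mul, neg_one_mul, neg_neg]; exact max_eq_left (by linarith [hB0 k])
    have hlo := (read1_lo_bounds (U := U) (κ₁ := κ₁) hA hmod0 hc1 hD (Bk k)).1
    have hhi := (read1_hi_bounds (U := U) (κ₁ := κ₁) hA hmod0 hc1 hD (Bk k)).2
    have f5 := FX5 k hk
    have f6 := FX6 k hk
    constructor
    · show -fw ≤ e₁ + X1lo k
      have e : X1lo k = (c₁ * (A * (U * (-Bk k - 1)))) / D := by simp only [X1lo, hmb]
      rw [e]
      exact le_of_mul_le_mul_left (by linarith) hmod0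
    · show e₁ + X1hi k + 1 ≤ fw
      have e : X1hi k = (c₁ * (A * (U * Bk k + U - 1))) / D := by simp only [X1hi, hMb]
      rw [e]
      exact le_of_mul_le_mul_left (by linarith) hmod0

end Skelφ

end Summit.CriticalPhenomena.PercolationContinuityZ3.Theorems.Transplant
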